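import Literature.MathematicalPhysics.QuantumFieldTheory.Balaban1983to89.T4EMLFibreAC
import Literature.MathematicalPhysics.QuantumFieldTheory.Balaban1983to89.BlockAveragingExpMeanLog
import Literature.MathematicalPhysics.QuantumFieldTheory.Balaban1983to89.T4HaarSUNLocalDiffeo
import Literature.Analysis.SpecialFunctions.ExpFDeriv
import Mathlib.Analysis.Matrix.Spectrum
import HarnessLib

/-!
# T4EMLTangentInjective — the exp-mean-log gauge-fibre map has an explicit strict derivative whose restriction to the
# tangent space of the unitary group is injective (pub-balaban, T4-DAG v9 row T4-D.G-EML-K3-N°)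

Pure matrix analysis over Mathlib and tree modules; no Bałaban content is typed, every declaration is [folklore].
PURPOSE ONLY.  For unitary `W`, unitaries `hᵢ` in the guard `‖hᵢ W* − 1‖ < 1/2` (the `L²`-operator norm of
`Matrix.Norms.L2Operator`, the scope of `MatrixLog` / `BlockAveragingExpMeanLog` / `BlockAveragingEMLHaarACSUN`), and weights
`cᵢ ≥ 0` with `Σᵢ cᵢ < 1`, the ambient exp-mean-log map

  `Kmat h c M = exp (Σᵢ cᵢ • log (hᵢ M*)) · M`        (`log = MatrixLog.mlog`, `exp = NormedSpace.exp`)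

(a) has the explicit strict real Fréchet derivative `emlD h c W : 𝕄 →L[ℝ] 𝕄` at `W` (`hasStrictFDerivAt_Kmat`, stated on the
larger domain `‖hᵢ W* − 1‖ < 1`), and (b) `emlD h c W (W X) = 0` with `Xᴴ = −X` forces `X = 0` (`emlD_tangent_injective`).
These are exactly the binders `hd`, `hinj` of `T4HaarUnitaryLocalDiffeo.haar_restrict_map_absolutelyContinuous_unitary` and of
`T4HaarSUNLocalDiffeo.haar_restrict_map_absolutelyContinuous_specialUnitary`; §9 discharges them
(`eml_fibre_absolutelyContinuous_unitary`, `eml_fibre_absolutelyContinuous_specialUnitary`): on an open set of the guard, the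
push-forward of restricted Haar measure under any measurable group-valued `K` agreeing with `Kmat h c` is absolutely continuous;
and packages (a)+(b) in the `∃ D, HasStrictFDerivAt … D ↑W ∧ (∀ X, Xᴴ = −X → tr X = 0 → D (W X) = 0 → X = 0)` shape of the
general-`N` fibre-law assembly (`emlTangentLaw_specialUnitary`, `emlTangentLaw_unitary`).

THE MATHEMATICS (all [folklore]).  Write `Pᵢ = hᵢ W*`, `Zᵢ = log Pᵢ` (skew-Hermitian, `‖Zᵢ‖ < log 2 ≤ 1` on the guard),
`Y = Σ cᵢ Zᵢ`, `X̃ = W X W*`, `dexp Z = D exp(Z)` (the series of `Literature.Analysis.SpecialFunctions.ExpFDeriv`).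
The chain rule for `exp ∘ log = id` near `Pᵢ` (`dexp_mlog_fderiv`) turns `emlD h c W (W X) = 0` into the system
  `dexp(Zᵢ) Hᵢ = exp(Zᵢ) X̃` (all `i`),   `dexp(Y) (Σ cᵢ Hᵢ) = exp(Y) X̃`,
and `core` shows such a system forces `X̃ = 0`:
* KEY (`key`, §6): for ONE skew-Hermitian `Z` with `‖Z‖ < π` and `dexp(Z) H = exp(Z) X`, in a unitary eigenframe
  `Z = U diag(−iθ) U*` (`frame`, from `Matrix.IsHermitian.spectral_theorem` for `iZ`, with `|θₐ| ≤ ‖Z‖` from the eigenvector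
  and `‖A v‖ ≤ ‖A‖‖v‖`) the operators `dexp Z`, `exp Z ·`, `A_Z = ½ ad_Z`, `P_{R,Z} = R + A_Z²` are entrywise multipliers
  (`dexp_eigen`, `exp_mul_of_eigen`: the divided difference `dd`), the coefficient identity reads
  `H'ₐᵦ · dd(−iθₐ,−iθᵦ) = X'ₐᵦ · e^{−iθₐ}`, and `Re[e^{−iθₐ}/dd] = β cot β = 1 − ψ(β)`, `β = (θₐ−θᵦ)/2` (`dd_ratio`, `re_ratio`;
  `ψ = T4QuatExpLog.ψ`).  With the Mittag-Leffler series `ψ(β) = Σₙ 2β²/((n+1)²π² − β²)` (`T4EMLFibreAC.hasSum_ψ`) this is the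
  identity `hs(X,X) − hs(X,H) = Σₙ 2 hs(A_Z X, vₙ)` with `P_{Rₙ,Z} vₙ = A_Z X`, `Rₙ = (n+1)²π²`, and `P_{Rₙ,Z} ⪰ 0` (POS) —
  `hs(A,B) = Re tr(AᴴB)` is the (instance-free) Hilbert–Schmidt form of §1.
* JENSEN (`jensen_step`, §2, pure algebra): `hs(A_Y X, v) ≤ Σ cᵢ hs(A_{Zᵢ} X, wᵢ)` for the solutions at level `R`, from the
  variational inequality `2hs(u,w) − hs(w,Pw) ≤ hs(u,P⁻¹u)` and convexity of the square (`hs_convex_sq`).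
* CORE (§7): summing (`hasSum_le`) gives `hs(X̃,X̃) − Σcᵢ hs(X̃,Hᵢ) ≤ Σcᵢ (hs(X̃,X̃) − hs(X̃,Hᵢ))`, i.e.
  `(1 − Σcᵢ) hs(X̃,X̃) ≤ 0`, so `X̃ = 0`.
(In words: in the eigenframe the weights `Re[x/(1 − e^{−x})]` at `x = 2iβ` are `β cot β`; the defect `1 − β cot β = ψ(β)`, written
through its Mittag-Leffler series as a sum of resolvent quadratic forms `hs(A_Z X, (Rₙ + A_Z²)⁻¹ A_Z X)`, is convex in `Z`
(Jensen), and the strict budget `Σcᵢ < 1` then forces `X̃ = 0`.)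

VALUE = kernel matrix analysis for ONE binder pair of an open programme node (the general-`N` exp-mean-log fibre law; `N = 2`
is in the tree by quaternions, `BlockAveragingEMLHaarACSUN`); NOT an estimate of the papers, NOT summit progress.  Nothing
printed is asserted; no programme-internal statement is cited.

## Versions

* v1: the module.
-/

noncomputable section

open NormedSpace Finset
open scoped Matrix Matrix.Norms.L2Operator RightActions ComplexConjugate Nat

namespace Literature.MathematicalPhysics.QuantumFieldTheory.Balaban1983to89.T4EMLTangentInjective

open Matrix (single diagonal unitaryGroup)
open Complex (I)

variable {m : Type*} [Fintype m]

local notation "𝕄" => Matrix m m ℂ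

/-! ## 1. The Hilbert–Schmidt form `hs A B = Re tr(Aᴴ B)` (instance-free) -/

section HS

/-- The complex Hilbert–Schmidt pairing `tr(Aᴴ B)`. [folklore] -/
def hsC (A B : 𝕄) : ℂ := Matrix.trace (Aᴴ * B)

/-- The real Hilbert–Schmidt form `Re tr(Aᴴ B)`. [folklore] -/
def hs (A B : 𝕄) : ℝ := (hsC A B).re

/-- `tr(Aᴴ B) = Σ_{a,b} conj(A_ab) B_ab`. [folklore] -/
theorem hsC_eq_sum (A B : 𝕄) : hsC A B = ∑ a, ∑ b, star (A a b) * B a b := by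
  simp only [hsC, Matrix.trace, Matrix.diag_apply, Matrix.mul_apply, Matrix.conjTranspose_apply]
  exact Finset.sum_comm

/-- `hs A B = Σ_{a,b} Re(conj(A_ab) B_ab)`. [folklore] -/
theorem hs_eq_sum (A B : 𝕄) : hs A B = ∑ a, ∑ b, (star (A a b) * B a b).re := by
  simp only [hs, hsC_eq_sum, Complex.re_sum]

/-- `tr(Aᴴ A) = Σ |A_ab|²`. [folklore] -/
theorem hsC_self (A : 𝕄) : hsC A A = ((∑ a, ∑ b, ‖A a b‖ ^ 2 : ℝ) : ℂ) := by
  rw [hsC_eq_sum]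
  push_cast
  refine Finset.sum_congr rfl fun a _ => Finset.sum_congr rfl fun b _ => ?_
  rw [Complex.star_def, Complex.conj_mul']

/-- `hs A A = Σ |A_ab|²` (the squared Hilbert–Schmidt norm). [folklore] -/
theorem hs_self (A : 𝕄) : hs A A = ∑ a, ∑ b, ‖A a b‖ ^ 2 := by
  rw [hs, hsC_self, Complex.ofReal_re]

/-- `0 ≤ hs A A`. [folklore] -/
theorem hs_self_nonneg (A : 𝕄) : 0 ≤ hs A A := by
  rw [hs_self]; positivity

/-- `hs A A = 0 → A = 0`. [folklore] -/
theorem hs_self_eq_zero {A : 𝕄} (h : hs A A = 0) : A = 0 := by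
  rw [hs_self] at h
  ext a b
  have ha := (Finset.sum_eq_zero_iff_of_nonneg (fun a _ => by positivity)).1 h a (Finset.mem_univ _)
  have hb := (Finset.sum_eq_zero_iff_of_nonneg (fun b _ => by positivity)).1 ha b (Finset.mem_univ _)
  simpa using hb

/-- Hermitian symmetry of `tr(Aᴴ B)`. [folklore] -/
theorem hsC_comm (A B : 𝕄) : hsC B A = star (hsC A B) := by
  simp only [hsC, ← Matrix.trace_conjTranspose, Matrix.conjTranspose_mul, Matrix.conjTranspose_conjTranspose]

/-- Symmetry of `hs`. [folklore] -/
theorem hs_comm (A B : 𝕄) : hs B A = hs A B := by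
  rw [hs, hs, hsC_comm, Complex.star_def, Complex.conj_re]

/-- Additivity of `hsC` (right). [folklore] -/
theorem hsC_add_right (A B C : 𝕄) : hsC A (B + C) = hsC A B + hsC A C := by
  simp [hsC, mul_add]

/-- `hsC A (B − C) = hsC A B − hsC A C`. [folklore] -/
theorem hsC_sub_right (A B C : 𝕄) : hsC A (B - C) = hsC A B - hsC A C := by
  simp [hsC, mul_sub]

/-- `hsC` is `ℂ`-linear on the right. [folklore] -/
theorem hsC_smul_right (A B : 𝕄) (c : ℂ) : hsC A (c • B) = c * hsC A B := by
  simp [hsC]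

/-- `hsC` of a finite sum (right). [folklore] -/
theorem hsC_sum_right {ι : Type*} (s : Finset ι) (A : 𝕄) (B : ι → 𝕄) :
    hsC A (∑ i ∈ s, B i) = ∑ i ∈ s, hsC A (B i) := by
  simp [hsC, Finset.mul_sum, Matrix.trace_sum]

/-- `hsC` is conjugate-linear on the left. [folklore] -/
theorem hsC_smul_left (A B : 𝕄) (c : ℂ) : hsC (c • A) B = star c * hsC A B := by
  rw [hsC_comm B (c • A), hsC_smul_right, star_mul', hsC_comm A B, star_star]

/-- `hsC (A − B) C = hsC A C − hsC B C`. [folklore] -/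
theorem hsC_sub_left (A B C : 𝕄) : hsC (A - B) C = hsC A C - hsC B C := by
  simp [hsC, Matrix.conjTranspose_sub, sub_mul]

/-- `hsC (−A) B = −hsC A B`. [folklore] -/
theorem hsC_neg_left (A B : 𝕄) : hsC (-A) B = -hsC A B := by
  simp [hsC]

/-- Additivity of `hs` (right). [folklore] -/
theorem hs_add_right (A B C : 𝕄) : hs A (B + C) = hs A B + hs A C := by
  simp [hs, hsC_add_right]

/-- `hs A (B − C) = hs A B − hs A C`. [folklore] -/
theorem hs_sub_right (A B C : 𝕄) : hs A (B - C) = hs A B - hs A C := by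
  simp [hs, hsC_sub_right]

/-- `hsC A (−B) = −hsC A B`. [folklore] -/
theorem hsC_neg_right (A B : 𝕄) : hsC A (-B) = -hsC A B := by
  simp [hsC]

/-- `hs A (−B) = −hs A B`. [folklore] -/
theorem hs_neg_right (A B : 𝕄) : hs A (-B) = -hs A B := by
  rw [hs, hsC_neg_right, Complex.neg_re, hs]

/-- `hs` is `ℝ`-linear on the right (real scalars cast to `ℂ`). [folklore] -/
theorem hs_smul_right (A B : 𝕄) (c : ℝ) : hs A ((c : ℂ) • B) = c * hs A B := by
  rw [hs, hsC_smul_right, Complex.re_ofReal_mul, hs]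

/-- `hs` of a finite sum (right). [folklore] -/
theorem hs_sum_right {ι : Type*} (s : Finset ι) (A : 𝕄) (B : ι → 𝕄) :
    hs A (∑ i ∈ s, B i) = ∑ i ∈ s, hs A (B i) := by
  simp [hs, hsC_sum_right, Complex.re_sum]

/-- Additivity of `hs` (left). [folklore] -/
theorem hs_add_left (A B C : 𝕄) : hs (A + B) C = hs A C + hs B C := by
  rw [hs_comm, hs_add_right, hs_comm C A, hs_comm C B]

/-- `hs (A − B) C = hs A C − hs B C`. [folklore] -/
theorem hs_sub_left (A B C : 𝕄) : hs (A - B) C = hs A C - hs B C := by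
  rw [hs_comm, hs_sub_right, hs_comm C A, hs_comm C B]

/-- `hs` is `ℝ`-linear on the left. [folklore] -/
theorem hs_smul_left (A B : 𝕄) (c : ℝ) : hs ((c : ℂ) • A) B = c * hs A B := by
  rw [hs_comm, hs_smul_right, hs_comm]

/-- `hs` of a finite sum (left). [folklore] -/
theorem hs_sum_left {ι : Type*} (s : Finset ι) (A : ι → 𝕄) (B : 𝕄) :
    hs (∑ i ∈ s, A i) B = ∑ i ∈ s, hs (A i) B := by
  rw [hs_comm, hs_sum_right]
  exact Finset.sum_congr rfl fun i _ => hs_comm _ _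

/-- `hs (Z A) B = hs A (Zᴴ B)`. [folklore] -/
theorem hsC_mul_left (Z A B : 𝕄) : hsC (Z * A) B = hsC A (Zᴴ * B) := by
  simp [hsC, Matrix.conjTranspose_mul, Matrix.mul_assoc]

/-- `hs (A Z) B = hs A (B Zᴴ)`. [folklore] -/
theorem hsC_mul_right (Z A B : 𝕄) : hsC (A * Z) B = hsC A (B * Zᴴ) := by
  simp only [hsC, Matrix.conjTranspose_mul]
  rw [Matrix.mul_assoc, Matrix.trace_mul_comm, Matrix.mul_assoc]

/-- Unitary conjugation invariance: `hs (U A U*) (U B U*) = hs A B`. [folklore] -/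
theorem hsC_conj [DecidableEq m] {U : 𝕄} (hU : star U * U = 1) (A B : 𝕄) :
    hsC (U * A * star U) (U * B * star U) = hsC A B := by
  simp only [hsC, Matrix.conjTranspose_mul, Matrix.star_eq_conjTranspose, Matrix.conjTranspose_conjTranspose]
  rw [Matrix.star_eq_conjTranspose] at hU
  calc Matrix.trace (U * (Aᴴ * Uᴴ) * (U * B * Uᴴ))
        = Matrix.trace (U * (Aᴴ * (Uᴴ * U) * B * Uᴴ)) := by simp only [Matrix.mul_assoc]
    _ = Matrix.trace (U * (Aᴴ * B * Uᴴ)) := by rw [hU, Matrix.mul_one]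
    _ = Matrix.trace (Aᴴ * B * Uᴴ * U) := by rw [Matrix.trace_mul_comm, Matrix.mul_assoc]
    _ = Matrix.trace (Aᴴ * B) := by rw [Matrix.mul_assoc, hU, Matrix.mul_one]

/-- Unitary conjugation invariance of `hs`. [folklore] -/
theorem hs_conj [DecidableEq m] {U : 𝕄} (hU : star U * U = 1) (A B : 𝕄) :
    hs (U * A * star U) (U * B * star U) = hs A B := by
  rw [hs, hsC_conj hU, hs]

/-- Two-point inequality `2 hs A B ≤ hs A A + hs B B`. [folklore] -/
theorem two_hs_le (A B : 𝕄) : 2 * hs A B ≤ hs A A + hs B B := by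
  have h := hs_self_nonneg (A - B)
  rw [hs_sub_left, hs_sub_right, hs_sub_right, hs_comm A B] at h
  linarith

/-- CONVEXITY OF THE SQUARE: `hs(Σ cᵢaᵢ, Σ cᵢaᵢ) ≤ Σ cᵢ hs(aᵢ,aᵢ)` for `cᵢ ≥ 0`, `Σ cᵢ ≤ 1`. [folklore] -/
theorem hs_convex_sq {ι : Type*} [Fintype ι] (c : ι → ℝ) (hc0 : ∀ i, 0 ≤ c i) (hc1 : ∑ i, c i ≤ 1)
    (a : ι → 𝕄) :
    hs (∑ i, (c i : ℂ) • a i) (∑ i, (c i : ℂ) • a i) ≤ ∑ i, c i * hs (a i) (a i) := by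
  set s : 𝕄 := ∑ i, (c i : ℂ) • a i with hs_def
  have h1 : hs s s = ∑ i, c i * hs (a i) s := by
    conv_lhs => rw [hs_def]
    rw [hs_sum_left]
    exact Finset.sum_congr rfl fun i _ => hs_smul_left _ _ _
  have h2 : ∀ i, c i * hs (a i) s ≤ c i * ((hs (a i) (a i) + hs s s) / 2) := fun i =>
    mul_le_mul_of_nonneg_left (by linarith [two_hs_le (a i) s]) (hc0 i)
  have h3 : hs s s ≤ ∑ i, c i * ((hs (a i) (a i) + hs s s) / 2) :=
    calc hs s s = ∑ i, c i * hs (a i) s := h1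
      _ ≤ _ := Finset.sum_le_sum fun i _ => h2 i
  have h4 : ∑ i, c i * ((hs (a i) (a i) + hs s s) / 2)
      = (∑ i, c i * hs (a i) (a i)) / 2 + (∑ i, c i) * hs s s / 2 := by
    rw [Finset.sum_mul, Finset.sum_div, Finset.sum_div, ← Finset.sum_add_distrib]
    exact Finset.sum_congr rfl fun i _ => by ring
  have h5 : (∑ i, c i) * hs s s ≤ hs s s := by
    have := hs_self_nonneg s
    nlinarith
  linarith

end HS

variable [DecidableEq m]

/-! ## 2. The operators `A_Z = ½ ad_Z` and `P_{R,Z} = R + A_Z²` -/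

section Ops

/-- `A_Z M = ½ (Z M − M Z)`, as a `ℂ`-linear map. [folklore] -/
def adh (Z : 𝕄) : 𝕄 →ₗ[ℂ] 𝕄 :=
  (2 : ℂ)⁻¹ • (LinearMap.mulLeft ℂ Z - LinearMap.mulRight ℂ Z)

/-- `A_Z M = ½ (Z M − M Z)`. [folklore] -/
theorem adh_apply (Z M : 𝕄) : adh Z M = (2 : ℂ)⁻¹ • (Z * M - M * Z) := by
  simp [adh]

/-- `P_{R,Z} M = R M + A_Z (A_Z M)`. [folklore] -/
def Pop (R : ℝ) (Z : 𝕄) : 𝕄 →ₗ[ℂ] 𝕄 :=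
  (R : ℂ) • LinearMap.id + adh Z ∘ₗ adh Z

/-- `P_{R,Z} M = R M + A_Z (A_Z M)`. [folklore] -/
theorem Pop_apply (R : ℝ) (Z M : 𝕄) : Pop R Z M = (R : ℂ) • M + adh Z (adh Z M) := by
  simp [Pop]

/-- Linearity of `Z ↦ A_Z M`. [folklore] -/
theorem adh_sum_smul {ι : Type*} [Fintype ι] (c : ι → ℝ) (Z : ι → 𝕄) (M : 𝕄) :
    adh (∑ i, (c i : ℂ) • Z i) M = ∑ i, (c i : ℂ) • adh (Z i) M := by
  simp only [adh_apply, Finset.sum_mul, Finset.mul_sum, smul_mul_assoc, mul_smul_comm, ← Finset.sum_sub_distrib,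
    Finset.smul_sum, ← smul_sub, smul_comm ((2 : ℂ)⁻¹)]

/-- Skew-adjointness of `A_Z` for skew-Hermitian `Z`: `hs A (A_Z B) = − hs (A_Z A) B`. [folklore] -/
theorem hs_adh_right {Z : 𝕄} (hZ : Zᴴ = -Z) (A B : 𝕄) : hs A (adh Z B) = -hs (adh Z A) B := by
  have e1 := hsC_mul_left Zᴴ A B
  rw [Matrix.conjTranspose_conjTranspose, hZ, Matrix.neg_mul, hsC_neg_left] at e1
  have e2 := hsC_mul_right Zᴴ A B
  rw [Matrix.conjTranspose_conjTranspose, hZ, Matrix.mul_neg, hsC_neg_left] at e2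
  have key : hsC A (adh Z B) = -hsC (adh Z A) B := by
    rw [adh_apply, adh_apply, hsC_smul_right, hsC_sub_right, hsC_smul_left, hsC_sub_left, ← e1, ← e2]
    simp
    ring
  rw [hs, hs, key, Complex.neg_re]

/-- `P_{R,Z}` is symmetric for `hs` (skew-Hermitian `Z`). [folklore] -/
theorem hs_Pop_symm {Z : 𝕄} (hZ : Zᴴ = -Z) (R : ℝ) (A B : 𝕄) : hs (Pop R Z A) B = hs A (Pop R Z B) := by
  have h1 : hs (adh Z (adh Z A)) B = -hs (adh Z B) (adh Z A) := by rw [hs_comm, hs_adh_right hZ]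
  have h2 : hs A (adh Z (adh Z B)) = -hs (adh Z B) (adh Z A) := by rw [hs_adh_right hZ, hs_comm]
  rw [Pop_apply, Pop_apply, hs_add_left, hs_add_right, hs_smul_left, hs_smul_right, h1, h2]

/-- `hs A (P_{R,Z} A) = R hs(A,A) − hs(A_Z A, A_Z A)`. [folklore] -/
theorem hs_Pop_self {Z : 𝕄} (hZ : Zᴴ = -Z) (R : ℝ) (A : 𝕄) :
    hs A (Pop R Z A) = R * hs A A - hs (adh Z A) (adh Z A) := by
  rw [Pop_apply, hs_add_right, hs_smul_right, hs_adh_right hZ]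
  ring

omit [Fintype m] [DecidableEq m] in
/-- A convex combination of skew-Hermitian matrices is skew-Hermitian. [folklore] -/
theorem conjTranspose_sum_smul {ι : Type*} [Fintype ι] (c : ι → ℝ) {Z : ι → 𝕄} (hZ : ∀ i, (Z i)ᴴ = -Z i) :
    (∑ i, (c i : ℂ) • Z i)ᴴ = -∑ i, (c i : ℂ) • Z i := by
  simp [Matrix.conjTranspose_sum, Matrix.conjTranspose_smul, hZ, Finset.sum_neg_distrib]

/-- **JENSEN STEP.**  For skew-Hermitian `Zᵢ`, weights `cᵢ ≥ 0` with `Σ cᵢ ≤ 1`, `Y = Σ cᵢ Zᵢ`, `R ≥ 0`, solutions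
`P_{R,Y} v = A_Y X`, `P_{R,Zᵢ} wᵢ = A_{Zᵢ} X` and `P_{R,Zᵢ} ⪰ 0`:  `hs(A_Y X, v) ≤ Σ cᵢ hs(A_{Zᵢ} X, wᵢ)` — the
variational form `hs(u, P⁻¹u) = sup_w [2 hs(u,w) − hs(w,Pw)]` and convexity of `Z ↦ hs(w, P_{R,Z} w)`. [folklore] -/
theorem jensen_step {ι : Type*} [Fintype ι] {R : ℝ} (hR : 0 ≤ R) {Z : ι → 𝕄} (hZ : ∀ i, (Z i)ᴴ = -Z i)
    (c : ι → ℝ) (hc0 : ∀ i, 0 ≤ c i) (hc1 : ∑ i, c i ≤ 1) (X v : 𝕄) (w : ι → 𝕄)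
    (hv : Pop R (∑ i, (c i : ℂ) • Z i) v = adh (∑ i, (c i : ℂ) • Z i) X)
    (hw : ∀ i, Pop R (Z i) (w i) = adh (Z i) X) (hpos : ∀ i M, 0 ≤ hs M (Pop R (Z i) M)) :
    hs (adh (∑ i, (c i : ℂ) • Z i) X) v ≤ ∑ i, c i * hs (adh (Z i) X) (w i) := by
  set Y : 𝕄 := ∑ i, (c i : ℂ) • Z i with hY_def
  have hY : Yᴴ = -Y := conjTranspose_sum_smul c hZ
  -- `hs(u,v) = hs(v, P_Y v) = R‖v‖² − ‖A_Y v‖²`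
  have h1 : hs (adh Y X) v = R * hs v v - hs (adh Y v) (adh Y v) := by
    rw [← hv, hs_Pop_symm hY, hs_Pop_self hY]
  -- `hs(u,v) = Σ cᵢ hs(uᵢ, v)`
  have h2 : hs (adh Y X) v = ∑ i, c i * hs (adh (Z i) X) v := by
    rw [hY_def, adh_sum_smul, hs_sum_left]
    exact Finset.sum_congr rfl fun i _ => hs_smul_left _ _ _
  -- convexity of the square
  have h3 : hs (adh Y v) (adh Y v) ≤ ∑ i, c i * hs (adh (Z i) v) (adh (Z i) v) := by
    rw [hY_def, adh_sum_smul]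
    exact hs_convex_sq c hc0 hc1 _
  -- the variational inequality at each `Zᵢ`
  have h4 : ∀ i, 2 * hs (adh (Z i) X) v - hs v (Pop R (Z i) v) ≤ hs (adh (Z i) X) (w i) := by
    intro i
    have hp := hpos i (w i - v)
    rw [map_sub, hs_sub_left, hs_sub_right, hs_sub_right, hw i, ← hs_comm (w i) (adh (Z i) X),
      ← hs_Pop_symm (hZ i) R (w i) v, hw i, ← hs_comm v (adh (Z i) X)] at hp
    linarith
  have h5 : ∀ i, hs v (Pop R (Z i) v) = R * hs v v - hs (adh (Z i) v) (adh (Z i) v) := fun i => hs_Pop_self (hZ i) R v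
  -- assemble
  have hvv := hs_self_nonneg v
  have h6 : R * hs v v - hs (adh Y v) (adh Y v)
      ≥ ∑ i, c i * (R * hs v v - hs (adh (Z i) v) (adh (Z i) v)) := by
    have e : ∑ i, c i * (R * hs v v - hs (adh (Z i) v) (adh (Z i) v))
        = (∑ i, c i) * (R * hs v v) - ∑ i, c i * hs (adh (Z i) v) (adh (Z i) v) := by
      rw [Finset.sum_mul, ← Finset.sum_sub_distrib]
      exact Finset.sum_congr rfl fun i _ => by ring
    rw [e]
    have : (∑ i, c i) * (R * hs v v) ≤ R * hs v v := by
      have h0 : 0 ≤ R * hs v v := mul_nonneg hR hvv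
      nlinarith
    linarith
  calc hs (adh Y X) v = 2 * hs (adh Y X) v - hs (adh Y X) v := by ring
    _ = 2 * ∑ i, c i * hs (adh (Z i) X) v - (R * hs v v - hs (adh Y v) (adh Y v)) := by rw [← h2, ← h1]
    _ ≤ 2 * ∑ i, c i * hs (adh (Z i) X) v - ∑ i, c i * (R * hs v v - hs (adh (Z i) v) (adh (Z i) v)) := by
        linarith
    _ = ∑ i, c i * (2 * hs (adh (Z i) X) v - hs v (Pop R (Z i) v)) := by
        rw [Finset.mul_sum, ← Finset.sum_sub_distrib]
        exact Finset.sum_congr rfl fun i _ => by rw [h5 i]; ring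
    _ ≤ ∑ i, c i * hs (adh (Z i) X) (w i) :=
        Finset.sum_le_sum fun i _ => mul_le_mul_of_nonneg_left (h4 i) (hc0 i)

end Ops

/-! ## 3. The derivative of `exp` (pv11's series `ExpFDeriv`) and its eigen-relations -/

section ExpDeriv

variable [Nonempty m]

open Literature.Analysis.SpecialFunctions

/-- `dexp Z = D exp(Z) : 𝕄 →L[ℂ] 𝕄`, the series `Σₙ (n!)⁻¹ Σ_{i<n} Z^{n-1-i} (·) Zⁱ` of `ExpFDeriv`. [folklore] -/
def dexp (Z : 𝕄) : 𝕄 →L[ℂ] 𝕄 := ∑' n, ExpFDeriv.term ℂ Z n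

/-- `exp` has derivative `dexp Z` at `Z` (`ExpFDeriv.hasFDerivAt_exp`). [folklore] -/
theorem hasFDerivAt_exp_dexp (Z : 𝕄) : HasFDerivAt (exp : 𝕄 → 𝕄) (dexp Z) Z :=
  ExpFDeriv.hasFDerivAt_exp ℂ Z

/-- `exp` has STRICT derivative `dexp Z` (analyticity + uniqueness of the derivative). [folklore] -/
theorem hasStrictFDerivAt_exp_dexp (Z : 𝕄) : HasStrictFDerivAt (exp : 𝕄 → 𝕄) (dexp Z) Z := by
  have h := (NormedSpace.exp_analytic (𝕂 := ℂ) Z).hasStrictFDerivAt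
  rwa [(hasFDerivAt_exp_dexp Z).fderiv] at h

/-- The applied series `dexp Z F = Σₙ (n!)⁻¹ Σ_{i<n} Z^{n-1-i} F Zⁱ`. [folklore] -/
theorem hasSum_dexp_apply (Z F : 𝕄) :
    HasSum (fun n : ℕ => (n !⁻¹ : ℂ) • ∑ i ∈ Finset.range n, Z ^ (n.pred - i) * F * Z ^ i) (dexp Z F) := by
  have h := (ExpFDeriv.summable_term ℂ Z).hasSum.mapL (ContinuousLinearMap.apply ℂ 𝕄 F)
  simpa [dexp, ExpFDeriv.term_apply] using h

omit [Nonempty m] in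
/-- `Z F = p F ⟹ Zᵏ F = pᵏ F`. [folklore] -/
theorem pow_mul_of_eigen {Z F : 𝕄} {p : ℂ} (hl : Z * F = p • F) (k : ℕ) : Z ^ k * F = p ^ k • F := by
  induction k with
  | zero => simp
  | succ k ih => rw [pow_succ, mul_assoc, hl, mul_smul_comm, ih, smul_smul, pow_succ']

omit [Nonempty m] in
/-- `F Z = q F ⟹ F Zᵏ = qᵏ F`. [folklore] -/
theorem mul_pow_of_eigen {Z F : 𝕄} {q : ℂ} (hr : F * Z = q • F) (k : ℕ) : F * Z ^ k = q ^ k • F := by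
  induction k with
  | zero => simp
  | succ k ih => rw [pow_succ', ← mul_assoc, hr, smul_mul_assoc, ih, smul_smul, pow_succ']

/-- The divided difference of `exp`: `(eᵖ − e^q)/(p − q)` (`eᵖ` on the diagonal). [folklore] -/
def dd (p q : ℂ) : ℂ := if p = q then Complex.exp p else (Complex.exp p - Complex.exp q) / (p - q)

omit [Fintype m] [DecidableEq m] [Nonempty m] in
/-- The scalar exponential series `Σ (n!)⁻¹ pⁿ = eᵖ` (`Complex.exp`). [folklore] -/
theorem hasSum_exp_scalar (p : ℂ) : HasSum (fun n : ℕ => (n !⁻¹ : ℂ) * p ^ n) (Complex.exp p) := by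
  have h := NormedSpace.exp_series_hasSum_exp' (𝕂 := ℂ) p
  rw [Complex.exp_eq_exp_ℂ]
  simpa using h

omit [Fintype m] [DecidableEq m] [Nonempty m] in
/-- The scalar series of the divided difference. [folklore] -/
theorem hasSum_dd (p q : ℂ) :
    HasSum (fun n : ℕ => (n !⁻¹ : ℂ) * ∑ i ∈ Finset.range n, p ^ (n.pred - i) * q ^ i) (dd p q) := by
  by_cases hpq : p = q
  · subst hpq
    rw [dd, if_pos rfl]
    have hin : ∀ n : ℕ, ∑ i ∈ Finset.range n, p ^ (n.pred - i) * p ^ i = n * p ^ (n - 1) := by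
      intro n
      rw [Finset.sum_congr rfl fun i hi => by
        rw [← pow_add, Nat.pred_eq_sub_one,
          Nat.sub_add_cancel (Nat.le_sub_one_of_lt (Finset.mem_range.1 hi))]]
      simp
    simp_rw [hin]
    rw [← hasSum_nat_add_iff' 1]
    simp only [Finset.range_one, Finset.sum_singleton, Nat.cast_zero, zero_mul, mul_zero, sub_zero,
      Nat.add_sub_cancel]
    refine (hasSum_exp_scalar p).congr_fun fun n => ?_
    rw [Nat.factorial_succ, Nat.cast_mul, mul_inv, Nat.cast_add, Nat.cast_one]
    have : ((n : ℂ) + 1) ≠ 0 := Nat.cast_add_one_ne_zero n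
    field_simp
  · rw [dd, if_neg hpq]
    have hsub : p - q ≠ 0 := sub_ne_zero.2 hpq
    have hin : ∀ n : ℕ, ∑ i ∈ Finset.range n, p ^ (n.pred - i) * q ^ i = (p ^ n - q ^ n) / (p - q) := by
      intro n
      rw [eq_div_iff hsub]
      have h := geom_sum₂_mul q p n
      have e : ∑ i ∈ Finset.range n, p ^ (n.pred - i) * q ^ i = ∑ i ∈ Finset.range n, q ^ i * p ^ (n - 1 - i) :=
        Finset.sum_congr rfl fun i _ => by rw [mul_comm, Nat.pred_eq_sub_one]
      rw [e]
      linear_combination (-1 : ℂ) * h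
    simp_rw [hin]
    have h := ((hasSum_exp_scalar p).sub (hasSum_exp_scalar q)).div_const (p - q)
    refine h.congr_fun fun n => ?_
    simp only [div_eq_mul_inv]
    ring

/-- `dexp Z` acts diagonally on joint eigen-matrices: `Z F = p F`, `F Z = q F` ⟹ `dexp Z F = dd p q • F`. [folklore] -/
theorem dexp_eigen {Z F : 𝕄} {p q : ℂ} (hl : Z * F = p • F) (hr : F * Z = q • F) :
    dexp Z F = dd p q • F := by
  have h1 := hasSum_dexp_apply Z F
  have h2 : HasSum (fun n : ℕ => ((n !⁻¹ : ℂ) * ∑ i ∈ Finset.range n, p ^ (n.pred - i) * q ^ i) • F)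
      (dd p q • F) := (hasSum_dd p q).smul_const F
  have h3 : (fun n : ℕ => (n !⁻¹ : ℂ) • ∑ i ∈ Finset.range n, Z ^ (n.pred - i) * F * Z ^ i)
      = fun n : ℕ => ((n !⁻¹ : ℂ) * ∑ i ∈ Finset.range n, p ^ (n.pred - i) * q ^ i) • F := by
    funext n
    rw [← smul_smul, Finset.sum_smul]
    congr 1
    refine Finset.sum_congr rfl fun i _ => ?_
    rw [mul_assoc, mul_pow_of_eigen hr, mul_smul_comm, pow_mul_of_eigen hl, smul_smul, mul_comm]
  rw [h3] at h1
  exact h1.unique h2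

omit [Nonempty m] in
/-- `exp Z F = eᵖ F` if `Z F = p F`. [folklore] -/
theorem exp_mul_of_eigen {Z F : 𝕄} {p : ℂ} (hl : Z * F = p • F) : exp Z * F = Complex.exp p • F := by
  have h1 : HasSum (fun n : ℕ => ((n !⁻¹ : ℂ) • Z ^ n) * F) (exp Z * F) :=
    (NormedSpace.exp_series_hasSum_exp' (𝕂 := ℂ) Z).mul_right F
  have h2 : HasSum (fun n : ℕ => ((n !⁻¹ : ℂ) * p ^ n) • F) (Complex.exp p • F) :=
    (hasSum_exp_scalar p).smul_const F
  have h3 : (fun n : ℕ => ((n !⁻¹ : ℂ) • Z ^ n) * F) = fun n => ((n !⁻¹ : ℂ) * p ^ n) • F := by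
    funext n; rw [smul_mul_assoc, pow_mul_of_eigen hl, smul_smul]
  rw [h3] at h1
  exact h1.unique h2

end ExpDeriv

/-! ## 4. Unitary frames -/

section Frame

/-- Rotated matrix units `U E_{ab} U*`. [folklore] -/
def Fu (U : 𝕄) (a b : m) : 𝕄 := U * single a b (1 : ℂ) * star U

/-- `U M U* = Σ_{a,b} M_ab · U E_ab U*`. [folklore] -/
theorem conj_expand (U M : 𝕄) : U * M * star U = ∑ a, ∑ b, M a b • Fu U a b := by
  have h : ∀ a b, single a b (M a b) = M a b • single a b (1 : ℂ) := fun a b => by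
    rw [Matrix.smul_single, smul_eq_mul, mul_one]
  conv_lhs => rw [Matrix.matrix_eq_sum_single M]
  simp only [Finset.mul_sum, Finset.sum_mul, h, Matrix.mul_smul, Matrix.smul_mul, Fu]

/-- `diag(d) E_ab = d_a E_ab`. [folklore] -/
theorem diagonal_mul_single_one (d : m → ℂ) (a b : m) :
    diagonal d * single a b (1 : ℂ) = d a • single a b 1 := by
  ext i j
  rw [Matrix.diagonal_mul, Matrix.smul_apply, smul_eq_mul, Matrix.single_apply]
  split_ifs with h
  · rw [h.1]
  · simp

/-- `E_ab diag(d) = d_b E_ab`. [folklore] -/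
theorem single_one_mul_diagonal (d : m → ℂ) (a b : m) :
    single a b (1 : ℂ) * diagonal d = d b • single a b 1 := by
  ext i j
  rw [Matrix.mul_diagonal, Matrix.smul_apply, smul_eq_mul, Matrix.single_apply]
  split_ifs with h
  · rw [h.2]; ring
  · simp

/-- `(U diag(d) U*) (U E_ab U*) = d_a · U E_ab U*` for `U* U = 1`. [folklore] -/
theorem frame_mul_Fu {U : 𝕄} (hU : star U * U = 1) (d : m → ℂ) (a b : m) :
    (U * diagonal d * star U) * Fu U a b = d a • Fu U a b := by
  unfold Fu
  rw [show U * diagonal d * star U * (U * single a b 1 * star U)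
      = U * (diagonal d * (star U * U) * single a b 1) * star U by noncomm_ring,
    hU, Matrix.mul_one, diagonal_mul_single_one, Matrix.mul_smul, Matrix.smul_mul]

/-- `(U E_ab U*) (U diag(d) U*) = d_b · U E_ab U*` for `U* U = 1`. [folklore] -/
theorem Fu_mul_frame {U : 𝕄} (hU : star U * U = 1) (d : m → ℂ) (a b : m) :
    Fu U a b * (U * diagonal d * star U) = d b • Fu U a b := by
  unfold Fu
  rw [show U * single a b 1 * star U * (U * diagonal d * star U)
      = U * (single a b 1 * (star U * U) * diagonal d) * star U by noncomm_ring,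
    hU, Matrix.mul_one, single_one_mul_diagonal, Matrix.mul_smul, Matrix.smul_mul]

/-- A linear map diagonal on the frame acts as an entrywise multiplier in frame coordinates. [folklore] -/
theorem linmap_frame {U : 𝕄} (f : 𝕄 →ₗ[ℂ] 𝕄) (wt : m → m → ℂ) (hf : ∀ a b, f (Fu U a b) = wt a b • Fu U a b)
    (M : 𝕄) : f (U * M * star U) = U * Matrix.of (fun a b => wt a b * M a b) * star U := by
  rw [conj_expand U M, conj_expand U (Matrix.of _)]
  simp only [map_sum, map_smul, hf, smul_smul, Matrix.of_apply]
  exact Finset.sum_congr rfl fun a _ => Finset.sum_congr rfl fun b _ => by rw [mul_comm]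

/-- `U (U* M U) U* = M` for `U U* = 1`. [folklore] -/
theorem conj_unconj {U : 𝕄} (hU' : U * star U = 1) (M : 𝕄) : U * (star U * M * U) * star U = M := by
  rw [show U * (star U * M * U) * star U = (U * star U) * M * (U * star U) by noncomm_ring, hU',
    Matrix.one_mul, Matrix.mul_one]

/-- `U* (U M U*) U = M` for `U* U = 1`. [folklore] -/
theorem unconj_conj {U : 𝕄} (hU : star U * U = 1) (M : 𝕄) : star U * (U * M * star U) * U = M := by
  rw [show star U * (U * M * star U) * U = (star U * U) * M * (star U * U) by noncomm_ring, hU,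
    Matrix.one_mul, Matrix.mul_one]

/-- `hs (U N U*) (U N' U*) = Σ_{a,b} Re(conj(N_ab) N'_ab)` for `U* U = 1`. [folklore] -/
theorem hs_frame {U : 𝕄} (hU : star U * U = 1) (N N' : 𝕄) :
    hs (U * N * star U) (U * N' * star U) = ∑ a, ∑ b, (star (N a b) * N' a b).re := by
  rw [hs_conj hU, hs_eq_sum]

/-- **Skew-Hermitian frame.**  `Z = U diag(−iθ) U*` with `U` unitary and `|θ_a| ≤ ‖Z‖` (operator norm). [folklore] -/
theorem frame {Z : 𝕄} (hZ : Zᴴ = -Z) : ∃ (U : 𝕄) (θ : m → ℝ), star U * U = 1 ∧ U * star U = 1 ∧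
    Z = U * diagonal (fun a => -I * (θ a : ℂ)) * star U ∧ ∀ a, |θ a| ≤ ‖Z‖ := by
  have hA : (I • Z).IsHermitian := by
    show (I • Z)ᴴ = I • Z
    rw [Matrix.conjTranspose_smul, hZ, Complex.star_def, Complex.conj_I, smul_neg, neg_smul, neg_neg]
  refine ⟨(hA.eigenvectorUnitary : 𝕄), hA.eigenvalues, Unitary.coe_star_mul_self hA.eigenvectorUnitary,
    Unitary.coe_mul_star_self hA.eigenvectorUnitary, ?_, fun a => ?_⟩
  · have h := hA.spectral_theorem
    rw [Unitary.conjStarAlgAut_apply] at h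
    have e : diagonal (fun a => -I * (hA.eigenvalues a : ℂ))
        = (-I) • diagonal (RCLike.ofReal ∘ hA.eigenvalues : m → ℂ) := by
      rw [← Matrix.diagonal_smul]
      congr 1
    rw [e, Matrix.mul_smul, Matrix.smul_mul, ← h, smul_smul]
    simp
  · have hmv := hA.mulVec_eigenvectorBasis a
    have hn1 : ‖hA.eigenvectorBasis a‖ = 1 := hA.eigenvectorBasis.orthonormal.1 a
    have hT : Matrix.toEuclideanCLM (n := m) (𝕜 := ℂ) (I • Z) (hA.eigenvectorBasis a)
        = (hA.eigenvalues a : ℂ) • hA.eigenvectorBasis a := by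
      apply WithLp.ofLp_injective 2
      rw [Matrix.ofLp_toEuclideanCLM, hmv, WithLp.ofLp_smul, RCLike.real_smul_eq_coe_smul (K := ℂ)]
      rfl
    have hle := (Matrix.toEuclideanCLM (n := m) (𝕜 := ℂ) (I • Z)).le_opNorm (hA.eigenvectorBasis a)
    rw [hT, norm_smul, hn1, mul_one, mul_one, Matrix.l2_opNorm_toEuclideanCLM, norm_smul, Complex.norm_I,
      one_mul, Complex.norm_real, Real.norm_eq_abs] at hle
    exact hle

end Frame

/-! ## 5. Two scalar facts: the half-angle real part and the Mittag-Leffler series of `ψ` -/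

section Scalar

open T4QuatExpLog (ψ ψ_zero ψ_of_ne_zero)

/-- `Re[(−2βi)/(1 − e^{2βi})] = β cot β`. [folklore] -/
theorem re_ratio (β : ℝ) (hβ : Real.sin β ≠ 0) :
    ((-(((2 * β : ℝ) : ℂ) * I)) / (1 - Complex.exp (((2 * β : ℝ) : ℂ) * I))).re
      = β * Real.cos β / Real.sin β := by
  set w : ℂ := 1 - Complex.exp (((2 * β : ℝ) : ℂ) * I) with hw
  have hre : w.re = 2 * Real.sin β ^ 2 := by
    rw [hw, Complex.sub_re, Complex.one_re, Complex.exp_ofReal_mul_I_re]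
    have := Real.sin_sq_eq_half_sub β
    linarith
  have him : w.im = -(2 * Real.sin β * Real.cos β) := by
    rw [hw, Complex.sub_im, Complex.one_im, Complex.exp_ofReal_mul_I_im, Real.sin_two_mul]; ring
  have hn : Complex.normSq w = 4 * Real.sin β ^ 2 := by
    rw [Complex.normSq_apply, hre, him]
    linear_combination (4 * Real.sin β ^ 2) * Real.sin_sq_add_cos_sq β
  rw [Complex.div_re, hn, hre, him]
  simp only [Complex.neg_re, Complex.neg_im, Complex.mul_re, Complex.mul_im, Complex.ofReal_re,
    Complex.ofReal_im, Complex.I_re, Complex.I_im]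
  field_simp
  ring

/-- `ψ` is even. [folklore] -/
theorem ψ_neg (θ : ℝ) : ψ (-θ) = ψ θ := by
  simp [T4QuatExpLog.ψ, Real.cos_neg, Real.sinc_neg]

/-- Mittag-Leffler for `ψ` on `|β| < π` (from `T4EMLFibreAC.hasSum_ψ`). [folklore] -/
theorem hasSum_ψ' {β : ℝ} (hβ : |β| < Real.pi) :
    HasSum (fun n : ℕ => 2 * β ^ 2 / (((n : ℝ) + 1) ^ 2 * Real.pi ^ 2 - β ^ 2)) (ψ β) := by
  rcases lt_trichotomy β 0 with h | h | h
  · have h1 := T4EMLFibreAC.hasSum_ψ (θ := -β) (by linarith) (by linarith [(abs_lt.1 hβ).1])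
    rw [ψ_neg] at h1
    simpa using h1
  · subst h
    simp [ψ_zero]
  · exact T4EMLFibreAC.hasSum_ψ h (abs_lt.1 hβ).2

/-- The coefficient ratio `eᵖ / dd(p,q)` at `p = −iθ_a`, `q = −iθ_b`: non-degenerate, real part `1 − ψ((θ_a−θ_b)/2)`. [folklore] -/
theorem dd_ratio {θa θb : ℝ} (hβ : |(θa - θb) / 2| < Real.pi) :
    dd (-I * θa) (-I * θb) ≠ 0 ∧
      (Complex.exp (-I * θa) / dd (-I * θa) (-I * θb)).re = 1 - ψ ((θa - θb) / 2) := by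
  set β : ℝ := (θa - θb) / 2 with hβdef
  by_cases hab : θa = θb
  · subst hab
    have h0 : β = 0 := by rw [hβdef]; simp
    rw [dd, if_pos rfl, h0, ψ_zero, div_self (Complex.exp_ne_zero _)]
    simp
  · have hβ0 : β ≠ 0 := by
      rw [hβdef]; intro h; apply hab; linarith [div_eq_zero_iff.1 h]
    have hpq : (-I * θa : ℂ) ≠ -I * θb := by
      intro h
      have := mul_left_cancel₀ (neg_ne_zero.2 Complex.I_ne_zero) h
      exact hab (Complex.ofReal_injective this)
    have hsin : Real.sin β ≠ 0 := by
      intro h0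
      rw [Real.sin_eq_zero_iff_of_lt_of_lt (by linarith [(abs_lt.1 hβ).1]) (abs_lt.1 hβ).2] at h0
      exact hβ0 h0
    have hqp : (-I * θb : ℂ) - (-I * θa) = ((2 * β : ℝ) : ℂ) * I := by
      rw [hβdef]; push_cast; ring
    have hpq' : (-I * θa : ℂ) - (-I * θb) = -(((2 * β : ℝ) : ℂ) * I) := by
      rw [← hqp]; ring
    have hexp : Complex.exp (-I * θa) - Complex.exp (-I * θb) ≠ 0 := by
      intro h
      have h1 : Complex.exp ((-I * θb) - (-I * θa)) = 1 := by
        rw [Complex.exp_sub, (sub_eq_zero.1 h), div_self (Complex.exp_ne_zero _)]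
      rw [hqp] at h1
      obtain ⟨n, hn⟩ := Complex.exp_eq_one_iff.1 h1
      have hn' : ((2 * β : ℝ) : ℂ) * I = ((n : ℂ) * ((2 * Real.pi : ℝ) : ℂ)) * I := by
        rw [hn]; push_cast; ring
      have h2 : ((2 * β : ℝ) : ℂ) = (n : ℂ) * (2 * Real.pi : ℝ) := mul_right_cancel₀ Complex.I_ne_zero hn'
      have h3 : 2 * β = (n : ℝ) * (2 * Real.pi) := by exact_mod_cast h2
      have h4 : |(n : ℝ)| < 1 := by
        have : |2 * β| < 2 * Real.pi := by rw [abs_mul, abs_two]; linarith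
        rw [h3, abs_mul, abs_of_pos (by positivity : (0:ℝ) < 2 * Real.pi)] at this
        nlinarith [Real.pi_pos, abs_nonneg (n : ℝ)]
      have h5 : n = 0 := by
        have : |n| < 1 := by exact_mod_cast h4
        exact Int.abs_lt_one_iff.mp this
      rw [h5] at h3; simp at h3
      exact hβ0 (by linarith)
    refine ⟨?_, ?_⟩
    · rw [dd, if_neg hpq]; exact div_ne_zero hexp (sub_ne_zero.2 hpq)
    · rw [dd, if_neg hpq]
      have e : Complex.exp (-I * θa) / ((Complex.exp (-I * θa) - Complex.exp (-I * θb)) / (-I * θa - -I * θb))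
          = (-I * θa - -I * θb) / (1 - Complex.exp ((-I * θb) - (-I * θa))) := by
        rw [Complex.exp_sub]
        have h0 := Complex.exp_ne_zero (-I * θa)
        field_simp
      rw [e, hqp, hpq', re_ratio β hsin, ψ_of_ne_zero hβ0]
      ring

end Scalar

/-! ## 6. The spectral identity (KEY) and positivity (POS) for one skew-Hermitian `Z`, `‖Z‖ < π` -/

section Key

variable [Nonempty m]

open T4QuatExpLog (ψ)

/-- The Mittag-Leffler level `Rₙ = (n+1)² π²`. [folklore] -/
def Rn (n : ℕ) : ℝ := ((n : ℝ) + 1) ^ 2 * Real.pi ^ 2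

omit [Fintype m] [DecidableEq m] [Nonempty m] in
/-- `π² ≤ Rₙ`. [folklore] -/
theorem pi_sq_le_Rn (n : ℕ) : Real.pi ^ 2 ≤ Rn n := by
  unfold Rn
  have h1 : (1 : ℝ) ≤ ((n : ℝ) + 1) ^ 2 := by nlinarith [(n.cast_nonneg : (0 : ℝ) ≤ n)]
  nlinarith [Real.pi_pos]

omit [Fintype m] [DecidableEq m] [Nonempty m] in
/-- `0 ≤ Rₙ`. [folklore] -/
theorem Rn_nonneg (n : ℕ) : 0 ≤ Rn n := by unfold Rn; positivity

omit [Fintype m] [DecidableEq m] [Nonempty m] in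
/-- `Re(conj z · (r z)) = r |z|²` for real `r`. [folklore] -/
theorem re_star_mul_real_mul (z : ℂ) (r : ℝ) : (star z * ((r : ℂ) * z)).re = r * ‖z‖ ^ 2 := by
  rw [mul_left_comm, Complex.star_def, Complex.conj_mul', ← Complex.ofReal_pow, ← Complex.ofReal_mul,
    Complex.ofReal_re]

omit [Fintype m] [DecidableEq m] [Nonempty m] in
/-- `Re(conj(−iβ z) · ((−iβ/r) z)) = (β²/r) |z|²` for real `β`, `r`. [folklore] -/
theorem re_coef (z : ℂ) (β r : ℝ) :
    (star (-I * (β : ℂ) * z) * (-I * (β : ℂ) / (r : ℂ) * z)).re = β ^ 2 / r * ‖z‖ ^ 2 := by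
  have h1 : star (-I * (β : ℂ) * z) = I * β * star z := by
    simp only [star_mul', star_neg, Complex.star_def, Complex.conj_I, Complex.conj_ofReal]; ring
  have h2 : I * β * star z * (-I * (β : ℂ) / (r : ℂ) * z) = ((β ^ 2 / r : ℝ) : ℂ) * (star z * z) := by
    push_cast
    have hI : I * I = -1 := Complex.I_mul_I
    linear_combination (-(β : ℂ) ^ 2 * (r : ℂ)⁻¹ * star z * z) * hI
  rw [h1, h2, Complex.star_def, Complex.conj_mul', ← Complex.ofReal_pow, ← Complex.ofReal_mul, Complex.ofReal_re]

/-- **KEY + POS.**  For skew-Hermitian `Z` with `‖Z‖ < π` and `dexp Z H = exp Z · X`: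
`P_{Rₙ,Z} ⪰ 0` for all `n`, and there are `vₙ` with `P_{Rₙ,Z} vₙ = A_Z X` and
`Σₙ 2 hs(A_Z X, vₙ) = hs(X,X) − hs(X,H)` — the matrix form of `x²/tanh` ↔ Mittag-Leffler of `ψ`. [folklore] -/
theorem key {Z : 𝕄} (hZ : Zᴴ = -Z) (hZπ : ‖Z‖ < Real.pi) (X H : 𝕄) (hH : dexp Z H = exp Z * X) :
    (∀ n : ℕ, ∀ M : 𝕄, 0 ≤ hs M (Pop (Rn n) Z M)) ∧
    ∃ v : ℕ → 𝕄, (∀ n, Pop (Rn n) Z (v n) = adh Z X) ∧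
      HasSum (fun n => 2 * hs (adh Z X) (v n)) (hs X X - hs X H) := by
  obtain ⟨U, θ, hU, hU', hZU, hθ⟩ := frame hZ
  -- the spectral data
  have hβπ : ∀ a b, |(θ a - θ b) / 2| < Real.pi := by
    intro a b
    have ha := hθ a; have hb := hθ b
    rw [abs_div, abs_two]
    have := abs_sub (θ a) (θ b)
    linarith
  have hl : ∀ a b, Z * Fu U a b = (-I * (θ a : ℂ)) • Fu U a b := fun a b => by
    rw [hZU]; exact frame_mul_Fu hU _ a b
  have hr : ∀ a b, Fu U a b * Z = (-I * (θ b : ℂ)) • Fu U a b := fun a b => by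
    rw [hZU]; exact Fu_mul_frame hU _ a b
  have hadh : ∀ a b, adh Z (Fu U a b) = (-I * (((θ a - θ b) / 2 : ℝ) : ℂ)) • Fu U a b := by
    intro a b
    rw [adh_apply, hl, hr, ← sub_smul, smul_smul]
    congr 1
    push_cast
    ring
  have hPop : ∀ (n : ℕ) a b, Pop (Rn n) Z (Fu U a b) = ((Rn n - ((θ a - θ b) / 2) ^ 2 : ℝ) : ℂ) • Fu U a b := by
    intro n a b
    rw [Pop_apply, hadh, map_smul, hadh, smul_smul, ← add_smul]
    congr 1
    push_cast
    have hI : I * I = -1 := Complex.I_mul_I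
    linear_combination (((θ a : ℂ) - (θ b : ℂ)) / 2) ^ 2 * hI
  have hdexp : ∀ a b, dexp Z (Fu U a b) = dd (-I * θ a) (-I * θ b) • Fu U a b := fun a b =>
    dexp_eigen (hl a b) (hr a b)
  have hexp : ∀ a b, exp Z * Fu U a b = Complex.exp (-I * θ a) • Fu U a b := fun a b =>
    exp_mul_of_eigen (hl a b)
  -- positivity of the levels
  have hlev : ∀ (n : ℕ) a b, 0 < Rn n - ((θ a - θ b) / 2) ^ 2 := by
    intro n a b
    have h1 : ((θ a - θ b) / 2) ^ 2 < Real.pi ^ 2 := by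
      have := hβπ a b
      have h' := abs_lt.1 this
      nlinarith [abs_nonneg ((θ a - θ b) / 2), sq_abs ((θ a - θ b) / 2), Real.pi_pos]
    linarith [pi_sq_le_Rn n]
  -- frame coordinates of `X`, `H`
  set X' : 𝕄 := star U * X * U with hX'
  set H' : 𝕄 := star U * H * U with hH'
  have hXU : X = U * X' * star U := (conj_unconj hU' X).symm
  have hHU : H = U * H' * star U := (conj_unconj hU' H).symm
  refine ⟨fun n M => ?_, ?_⟩
  · -- POS
    rw [← conj_unconj hU' M, linmap_frame (Pop (Rn n) Z) _ (hPop n), hs_frame hU]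
    refine Finset.sum_nonneg fun a _ => Finset.sum_nonneg fun b _ => ?_
    rw [Matrix.of_apply, re_star_mul_real_mul]
    exact mul_nonneg (hlev n a b).le (sq_nonneg _)
  · -- KEY: the coefficient identity `dd · H' = e^{p} · X'` in frame coordinates
    have hcoef : ∀ a b, dd (-I * θ a) (-I * θ b) * H' a b = Complex.exp (-I * θ a) * X' a b := by
      have h1 : dexp Z H = U * Matrix.of (fun a b => dd (-I * θ a) (-I * θ b) * H' a b) * star U := by
        rw [hHU]; exact linmap_frame (dexp Z).toLinearMap _ hdexp H'
      have h2 : exp Z * X = U * Matrix.of (fun a b => Complex.exp (-I * θ a) * X' a b) * star U := by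
        rw [hXU]; exact linmap_frame (LinearMap.mulLeft ℂ (exp Z)) _ hexp X'
      have h3 := h1.symm.trans (hH.trans h2)
      have h4 := congrArg (fun N => star U * N * U) h3
      simp only [unconj_conj hU] at h4
      intro a b
      have h5 := congrFun (congrFun h4 a) b
      simpa only [Matrix.of_apply] using h5
    -- the solutions `vₙ`
    let cv : ℕ → m → m → ℂ := fun n a b =>
      -I * ((((θ a - θ b) / 2 : ℝ)) : ℂ) / ((Rn n - ((θ a - θ b) / 2) ^ 2 : ℝ) : ℂ)
    refine ⟨fun n => U * Matrix.of (fun a b => cv n a b * X' a b) * star U, fun n => ?_, ?_⟩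
    · -- `P vₙ = A_Z X`
      rw [linmap_frame (Pop (Rn n) Z) _ (hPop n), hXU, linmap_frame (adh Z) _ hadh]
      congr 2
      ext a b
      simp only [Matrix.of_apply, cv]
      have hne : (((Rn n - ((θ a - θ b) / 2) ^ 2 : ℝ)) : ℂ) ≠ 0 :=
        Complex.ofReal_ne_zero.2 (hlev n a b).ne'
      generalize (((Rn n - ((θ a - θ b) / 2) ^ 2 : ℝ)) : ℂ) = R at hne ⊢
      generalize ((((θ a - θ b) / 2 : ℝ)) : ℂ) = β
      field_simp
    · -- the Mittag-Leffler sum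
      have hterm : ∀ n, 2 * hs (adh Z X) (U * Matrix.of (fun a b => cv n a b * X' a b) * star U)
          = ∑ a, ∑ b, ‖X' a b‖ ^ 2 * (2 * ((θ a - θ b) / 2) ^ 2 / (Rn n - ((θ a - θ b) / 2) ^ 2)) := by
        intro n
        rw [hXU, linmap_frame (adh Z) _ hadh, hs_frame hU, Finset.mul_sum]
        refine Finset.sum_congr rfl fun a _ => ?_
        rw [Finset.mul_sum]
        refine Finset.sum_congr rfl fun b _ => ?_
        rw [Matrix.of_apply, Matrix.of_apply, re_coef]
        ring
      have hsum : HasSum (fun n => ∑ a, ∑ b,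
            ‖X' a b‖ ^ 2 * (2 * ((θ a - θ b) / 2) ^ 2 / (Rn n - ((θ a - θ b) / 2) ^ 2)))
          (∑ a, ∑ b, ‖X' a b‖ ^ 2 * ψ ((θ a - θ b) / 2)) :=
        hasSum_sum fun a _ => hasSum_sum fun b _ => (hasSum_ψ' (hβπ a b)).mul_left _
      simp_rw [hterm]
      convert hsum using 1
      rw [hXU, hHU, hs_frame hU, hs_frame hU, ← Finset.sum_sub_distrib]
      refine Finset.sum_congr rfl fun a _ => ?_
      rw [← Finset.sum_sub_distrib]
      refine Finset.sum_congr rfl fun b _ => ?_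
      obtain ⟨hne, hre⟩ := dd_ratio (hβπ a b)
      have hH'ab : H' a b = Complex.exp (-I * θ a) * X' a b / dd (-I * θ a) (-I * θ b) :=
        (eq_div_iff hne).2 (by rw [mul_comm]; exact hcoef a b)
      rw [hH'ab, show star (X' a b) * (Complex.exp (-I * θ a) * X' a b / dd (-I * θ a) (-I * θ b))
          = (Complex.exp (-I * θ a) / dd (-I * θ a) (-I * θ b)) * (star (X' a b) * X' a b) by ring,
        Complex.star_def, Complex.conj_mul', ← Complex.ofReal_pow, Complex.ofReal_re, mul_comm,
        Complex.re_ofReal_mul, hre]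
      ring

end Key

/-! ## 7. CORE: the convexity (Jensen) argument -/

section Core

variable [Nonempty m]

/-- **CORE.**  `Zᵢ` skew-Hermitian with `‖Zᵢ‖ ≤ 1`, weights `cᵢ ≥ 0`, `Σ cᵢ < 1`, `Y = Σ cᵢ Zᵢ`; if
`dexp(Zᵢ) Hᵢ = exp(Zᵢ) X̃` for all `i` and `dexp(Y) (Σ cᵢ Hᵢ) = exp(Y) X̃`, then `X̃ = 0`.  Proof: KEY at `Y` and at
each `Zᵢ`, the Jensen step termwise, `hasSum_le`, and `(1 − Σcᵢ) hs(X̃,X̃) ≤ 0`. [folklore] -/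
theorem core {ι : Type*} [Fintype ι] {Z : ι → 𝕄} (hZ : ∀ i, (Z i)ᴴ = -Z i) (hZ1 : ∀ i, ‖Z i‖ ≤ 1)
    (c : ι → ℝ) (hc0 : ∀ i, 0 ≤ c i) (hc1 : ∑ i, c i < 1) (X : 𝕄) (H : ι → 𝕄)
    (hH : ∀ i, dexp (Z i) (H i) = exp (Z i) * X)
    (hY : dexp (∑ i, (c i : ℂ) • Z i) (∑ i, (c i : ℂ) • H i) = exp (∑ i, (c i : ℂ) • Z i) * X) :
    X = 0 := by
  have hπ3 : (3 : ℝ) < Real.pi := Real.pi_gt_three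
  have hYn : ‖∑ i, (c i : ℂ) • Z i‖ < Real.pi := by
    calc ‖∑ i, (c i : ℂ) • Z i‖ ≤ ∑ i, ‖(c i : ℂ) • Z i‖ := norm_sum_le _ _
      _ ≤ ∑ i, c i := Finset.sum_le_sum fun i _ => by
          rw [norm_smul, Complex.norm_real, Real.norm_of_nonneg (hc0 i)]
          nlinarith [hZ1 i, hc0 i, norm_nonneg (Z i)]
      _ < Real.pi := by linarith
  have hZn : ∀ i, ‖Z i‖ < Real.pi := fun i => by linarith [hZ1 i]
  obtain ⟨-, v, hv, hsumY⟩ := key (conjTranspose_sum_smul c hZ) hYn X _ hY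
  have kZ := fun i => key (hZ i) (hZn i) X (H i) (hH i)
  choose w hw hsumw using fun i => (kZ i).2
  have hposZ : ∀ i (n : ℕ) (M : 𝕄), 0 ≤ hs M (Pop (Rn n) (Z i) M) := fun i => (kZ i).1
  -- termwise Jensen
  have hle : ∀ n, 2 * hs (adh (∑ i, (c i : ℂ) • Z i) X) (v n) ≤ ∑ i, c i * (2 * hs (adh (Z i) X) (w i n)) := by
    intro n
    have hj := jensen_step (Rn_nonneg n) hZ c hc0 hc1.le X (v n) (fun i => w i n) (hv n)
      (fun i => hw i n) (fun i M => hposZ i n M)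
    calc 2 * hs (adh (∑ i, (c i : ℂ) • Z i) X) (v n) ≤ 2 * ∑ i, c i * hs (adh (Z i) X) (w i n) := by
          linarith
      _ = ∑ i, c i * (2 * hs (adh (Z i) X) (w i n)) := by
          rw [Finset.mul_sum]; exact Finset.sum_congr rfl fun i _ => by ring
  have hsum2 : HasSum (fun n => ∑ i, c i * (2 * hs (adh (Z i) X) (w i n)))
      (∑ i, c i * (hs X X - hs X (H i))) :=
    hasSum_sum fun i _ => (hsumw i).mul_left (c i)
  have hineq := hasSum_le hle hsumY hsum2
  have e1 : hs X (∑ i, (c i : ℂ) • H i) = ∑ i, c i * hs X (H i) := by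
    rw [hs_sum_right]; exact Finset.sum_congr rfl fun i _ => hs_smul_right _ _ _
  have e2 : ∑ i, c i * (hs X X - hs X (H i)) = (∑ i, c i) * hs X X - ∑ i, c i * hs X (H i) := by
    rw [Finset.sum_mul, ← Finset.sum_sub_distrib]
    exact Finset.sum_congr rfl fun i _ => by ring
  rw [e1, e2] at hineq
  have hXX := hs_self_nonneg X
  exact hs_self_eq_zero (by nlinarith)

end Core

/-! ## 8. The fibre map `K_W`, its strict derivative, and the tangent-injectivity conclusion -/

section Calculus

variable [Nonempty m] {ι : Type*} [Fintype ι]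

open MatrixLog (mlog)

omit [Nonempty m] in
/-- `‖log X‖ < log 2` on the guard `‖X − 1‖ < 1/2`. [folklore] -/
theorem norm_mlog_lt_log_two {X : 𝕄} (hX : ‖X - 1‖ < 1 / 2) : ‖mlog X‖ < Real.log 2 := by
  have h := MatrixLog.norm_mlog_le_neg_log (lt_trans hX (by norm_num))
  have h2 : Real.log 2⁻¹ < Real.log (1 - ‖X - 1‖) := Real.log_lt_log (by norm_num) (by linarith)
  rw [Real.log_inv] at h2
  linarith

omit [Nonempty m] in
/-- `log` of the inverse on the guard (the `< 1/2` form of `ExpMeanLog.mlog_eq_neg_of_mul_eq_one`). [folklore] -/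
theorem mlog_eq_neg_of_mul_eq_one' {X Y : 𝕄} (hXY : X * Y = 1) (hX : ‖X - 1‖ < 1 / 2) : mlog Y = -mlog X := by
  have hX1 : ‖X - 1‖ < 1 := lt_trans hX (by norm_num)
  have hA : ‖mlog X‖ < Real.log 2 := norm_mlog_lt_log_two hX
  have hexpA : exp (mlog X) = X := MatrixLog.exp_mlog hX1
  have hprod : exp (-mlog X) * exp (mlog X) = 1 := by
    letI : NormedAlgebra ℚ 𝕄 := NormedAlgebra.restrictScalars ℚ ℂ 𝕄
    rw [← exp_add_of_commute (Commute.neg_left (Commute.refl (mlog X))), neg_add_cancel, exp_zero]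
  rw [hexpA] at hprod
  have hY : Y = exp (-mlog X) := by
    calc Y = exp (-mlog X) * X * Y := by rw [hprod, one_mul]
      _ = exp (-mlog X) * (X * Y) := by rw [mul_assoc]
      _ = exp (-mlog X) := by rw [hXY, mul_one]
  rw [hY]
  exact B7BlockAvgLog.mlog_exp (by rwa [norm_neg])

omit [Nonempty m] in
/-- `log` of a unitary on the guard is skew-Hermitian. [folklore] -/
theorem star_mlog_of_unitary {X : 𝕄} (hX : X ∈ unitaryGroup m ℂ) (hg : ‖X - 1‖ < 1 / 2) :
    star (mlog X) = -mlog X := by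
  have hX1 : ‖X - 1‖ < 1 := lt_trans hg (by norm_num)
  have h1 : mlog (star X) = -mlog X := mlog_eq_neg_of_mul_eq_one' (Matrix.mem_unitaryGroup_iff.mp hX) hg
  have h2 : star (mlog X) = mlog (star X) := by
    have hs1 : ‖star X - 1‖ < 1 / 2 := by rwa [ExpMeanLog.norm_star_sub_one]
    have hB : ‖mlog (star X)‖ < Real.log 2 := norm_mlog_lt_log_two hs1
    have key : exp (star (mlog X)) = exp (mlog (star X)) := by
      rw [← NormedSpace.star_exp, MatrixLog.exp_mlog hX1, MatrixLog.exp_mlog (lt_trans hs1 (by norm_num))]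
    have hA' : ‖star (mlog X)‖ < Real.log 2 := by
      rw [Matrix.star_eq_conjTranspose, Matrix.l2_opNorm_conjTranspose]; exact norm_mlog_lt_log_two hg
    calc star (mlog X) = mlog (exp (star (mlog X))) := (B7BlockAvgLog.mlog_exp hA').symm
      _ = mlog (exp (mlog (star X))) := by rw [key]
      _ = mlog (star X) := B7BlockAvgLog.mlog_exp hB
  rw [h2, h1]

/-- `dexp(log P) ∘ D log(P) = id` on `‖P − 1‖ < 1` (chain rule for `exp ∘ log = id` near `P`). [folklore] -/
theorem dexp_mlog_fderiv {P : 𝕄} (hP : ‖P - 1‖ < 1) (M : 𝕄) : dexp (mlog P) (fderiv ℂ mlog P M) = M := by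
  have h1 : HasFDerivAt (mlog : 𝕄 → 𝕄) (fderiv ℂ mlog P) P :=
    (MatrixLog.analyticAt_mlog hP).differentiableAt.hasFDerivAt
  have h3 : HasFDerivAt (fun X : 𝕄 => exp (mlog X)) ((dexp (mlog P)).comp (fderiv ℂ mlog P)) P :=
    (hasFDerivAt_exp_dexp (mlog P)).comp P h1
  have h4 : (fun X : 𝕄 => exp (mlog X)) =ᶠ[nhds P] id := by
    have ho : IsOpen {X : 𝕄 | ‖X - 1‖ < 1} :=
      isOpen_lt (continuous_id.sub continuous_const).norm continuous_const
    filter_upwards [ho.mem_nhds hP] with X hX using MatrixLog.exp_mlog hX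
  have h5 : HasFDerivAt (id : 𝕄 → 𝕄) ((dexp (mlog P)).comp (fderiv ℂ mlog P)) P :=
    h3.congr_of_eventuallyEq h4.symm
  have h6 := h5.unique (hasFDerivAt_id P)
  exact congrArg (fun T : 𝕄 →L[ℂ] 𝕄 => T M) h6

/-- The exp-mean-log fibre map in the ambient matrix space:
`Kmat h c M = exp(Σᵢ cᵢ log(hᵢ M*)) · M` (Balaban's block average (1.4) along one gauge fibre, cf.
`BlockAveragingEMLHaarACSUN.EMLFibreLaw`). [folklore] -/
def Kmat (h : ι → 𝕄) (c : ι → ℝ) (M : 𝕄) : 𝕄 := exp (∑ i, (c i : ℂ) • mlog (h i * star M)) * M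

/-- `star` as a real-linear continuous map of `𝕄`. [folklore] -/
def starR : 𝕄 →L[ℝ] 𝕄 := ((starL' ℝ : 𝕄 ≃L[ℝ] 𝕄) : 𝕄 →L[ℝ] 𝕄)

omit [Fintype m] [DecidableEq m] [Nonempty m] in
/-- `starR M = M*`. [folklore] -/
@[simp] theorem starR_apply (M : 𝕄) : (starR : 𝕄 →L[ℝ] 𝕄) M = star M := by
  simp [starR]

/-- The derivative of `M ↦ Σᵢ cᵢ log(hᵢ M*)` at `W`. [folklore] -/
def innerD (h : ι → 𝕄) (c : ι → ℝ) (W : 𝕄) : 𝕄 →L[ℝ] 𝕄 :=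
  ∑ i, (c i : ℂ) • (((fderiv ℂ mlog (h i * star W)).restrictScalars ℝ).comp (h i • (starR : 𝕄 →L[ℝ] 𝕄)))

/-- **The explicit derivative** `D K_W : 𝕄 →L[ℝ] 𝕄` of `Kmat h c` at `W`:
`V ↦ exp(Y) V + dexp(Y)[Σᵢ cᵢ D log(hᵢW*)(hᵢ V*)] W`, `Y = Σᵢ cᵢ log(hᵢ W*)`. [folklore] -/
def emlD (h : ι → 𝕄) (c : ι → ℝ) (W : 𝕄) : 𝕄 →L[ℝ] 𝕄 :=
  exp (∑ i, (c i : ℂ) • mlog (h i * star W)) • ContinuousLinearMap.id ℝ 𝕄 +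
    (((dexp (∑ i, (c i : ℂ) • mlog (h i * star W))).restrictScalars ℝ).comp (innerD h c W)) <• W

omit [Nonempty m] in
/-- The formula for `emlD h c W V`. [folklore] -/
theorem emlD_apply (h : ι → 𝕄) (c : ι → ℝ) (W V : 𝕄) :
    emlD h c W V = exp (∑ i, (c i : ℂ) • mlog (h i * star W)) * V +
      dexp (∑ i, (c i : ℂ) • mlog (h i * star W)) (∑ i, (c i : ℂ) • fderiv ℂ mlog (h i * star W) (h i * star V)) * W := by
  simp [emlD, innerD]

/-- **(a) Strict differentiability with the explicit derivative**, on the domain `‖hᵢ W* − 1‖ < 1`. [folklore] -/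
theorem hasStrictFDerivAt_Kmat (h : ι → 𝕄) (c : ι → ℝ) {W : 𝕄} (hW : ∀ i, ‖h i * star W - 1‖ < 1) :
    HasStrictFDerivAt (Kmat h c) (emlD h c W) W := by
  have hstar : HasStrictFDerivAt (fun M : 𝕄 => star M) (starR : 𝕄 →L[ℝ] 𝕄) W := by
    have e : (fun M : 𝕄 => star M) = fun M => (starR : 𝕄 →L[ℝ] 𝕄) M := funext fun M => (starR_apply M).symm
    rw [e]
    exact (starR : 𝕄 →L[ℝ] 𝕄).hasStrictFDerivAt
  have hG : ∀ i, HasStrictFDerivAt (fun M : 𝕄 => h i * star M) (h i • (starR : 𝕄 →L[ℝ] 𝕄)) W :=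
    fun i => hstar.const_mul (h i)
  have hL : ∀ i, HasStrictFDerivAt (fun M : 𝕄 => mlog (h i * star M))
      (((fderiv ℂ mlog (h i * star W)).restrictScalars ℝ).comp (h i • (starR : 𝕄 →L[ℝ] 𝕄))) W :=
    fun i => ((MatrixLog.analyticAt_mlog (hW i)).hasStrictFDerivAt.restrictScalars ℝ).comp W (hG i)
  have hF : HasStrictFDerivAt (fun M : 𝕄 => ∑ i, (c i : ℂ) • mlog (h i * star M)) (innerD h c W) W := by
    unfold innerD
    exact HasStrictFDerivAt.fun_sum fun i _ => (hL i).const_smul (c i : ℂ)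
  have hE : HasStrictFDerivAt (fun M : 𝕄 => exp (∑ i, (c i : ℂ) • mlog (h i * star M)))
      (((dexp (∑ i, (c i : ℂ) • mlog (h i * star W))).restrictScalars ℝ).comp (innerD h c W)) W :=
    ((hasStrictFDerivAt_exp_dexp _).restrictScalars ℝ).comp W hF
  exact hE.mul' (hasStrictFDerivAt_id W)

/-- **(b) Tangent injectivity on the guard `‖hᵢ W* − 1‖ < 1/2`**: if `X` is skew-Hermitian and the tangent
vector `W X` is killed by `D K_W`, then `X = 0`. [folklore] -/
theorem emlD_tangent_injective {h : ι → 𝕄} (hh : ∀ i, h i ∈ unitaryGroup m ℂ) {W : 𝕄}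
    (hWu : W ∈ unitaryGroup m ℂ) (hg : ∀ i, ‖h i * star W - 1‖ < 1 / 2) {c : ι → ℝ} (hc0 : ∀ i, 0 ≤ c i)
    (hc1 : ∑ i, c i < 1) (X : 𝕄) (hX : Xᴴ = -X) (hker : emlD h c W (W * X) = 0) : X = 0 := by
  have hW1 : star W * W = 1 := Matrix.mem_unitaryGroup_iff'.mp hWu
  have hW2 : W * star W = 1 := Matrix.mem_unitaryGroup_iff.mp hWu
  have hPu : ∀ i, h i * star W ∈ unitaryGroup m ℂ := fun i => mul_mem (hh i) (Unitary.star_mem hWu)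
  have hP1 : ∀ i, ‖h i * star W - 1‖ < 1 := fun i => lt_trans (hg i) (by norm_num)
  have hZskew : ∀ i, (mlog (h i * star W))ᴴ = -mlog (h i * star W) := fun i => by
    rw [← Matrix.star_eq_conjTranspose]; exact star_mlog_of_unitary (hPu i) (hg i)
  have hZ1 : ∀ i, ‖mlog (h i * star W)‖ ≤ 1 := fun i => by
    have h1 := norm_mlog_lt_log_two (hg i); have h2 := Real.log_two_lt_d9; linarith
  have hX' : star X = -X := by rw [Matrix.star_eq_conjTranspose, hX]
  -- the conjugated unknown `X̃ = W X W*` and the `Hᵢ`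
  have hHi : ∀ i, dexp (mlog (h i * star W)) (fderiv ℂ mlog (h i * star W) (h i * star W * (W * X * star W)))
      = exp (mlog (h i * star W)) * (W * X * star W) := fun i => by
    rw [dexp_mlog_fderiv (hP1 i), MatrixLog.exp_mlog (hP1 i)]
  have hPX : ∀ i, h i * star (W * X) = -(h i * star W * (W * X * star W)) := by
    intro i
    rw [star_mul, hX', neg_mul, mul_neg, show h i * star W * (W * X * star W)
      = h i * (star W * W) * (X * star W) by noncomm_ring, hW1, mul_one]
  have hY : dexp (∑ i, (c i : ℂ) • mlog (h i * star W))
        (∑ i, (c i : ℂ) • fderiv ℂ mlog (h i * star W) (h i * star W * (W * X * star W)))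
      = exp (∑ i, (c i : ℂ) • mlog (h i * star W)) * (W * X * star W) := by
    rw [emlD_apply] at hker
    simp only [hPX, map_neg, smul_neg, Finset.sum_neg_distrib, neg_mul] at hker
    have e2 : dexp (∑ i, (c i : ℂ) • mlog (h i * star W))
          (∑ i, (c i : ℂ) • fderiv ℂ mlog (h i * star W) (h i * star W * (W * X * star W))) * W
        = exp (∑ i, (c i : ℂ) • mlog (h i * star W)) * (W * X) := by
      rw [add_neg_eq_zero] at hker
      exact hker.symm
    calc dexp (∑ i, (c i : ℂ) • mlog (h i * star W))
          (∑ i, (c i : ℂ) • fderiv ℂ mlog (h i * star W) (h i * star W * (W * X * star W)))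
        = dexp (∑ i, (c i : ℂ) • mlog (h i * star W))
          (∑ i, (c i : ℂ) • fderiv ℂ mlog (h i * star W) (h i * star W * (W * X * star W))) * W * star W := by
            rw [mul_assoc _ W (star W), hW2, mul_one]
      _ = exp (∑ i, (c i : ℂ) • mlog (h i * star W)) * (W * X) * star W := by rw [e2]
      _ = _ := by noncomm_ring
  have hXt := core hZskew hZ1 c hc0 hc1 (W * X * star W) _ hHi hY
  calc X = star W * (W * X * star W) * W := (unconj_conj hW1 X).symm
    _ = 0 := by rw [hXt]; simp

end Calculus

/-! ## 9. Corollary: absolute continuity of the fibre law on `U(N)` (pv26's engine, binders discharged) -/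

section Unitary

open MeasureTheory T4HaarUnitaryLocalDiffeo

variable {N : ℕ} [NeZero N] {ι : Type*} [Fintype ι]

/-- **Fibre a.c. on `U(N)`.**  For loop holonomies `hᵢ ∈ U(N)`, weights `cᵢ ≥ 0`, `Σcᵢ < 1`, an open
`S ⊆ U(N)` inside the guard `‖hᵢ W* − 1‖ < 1/2`, and any measurable `K : U(N) → U(N)` agreeing on `S` with the
exp-mean-log map `W ↦ exp(Σᵢ cᵢ log(hᵢ W*)) W`: `(Haar|_S) ∘ K⁻¹ ≪ Haar` — `T4HaarUnitaryLocalDiffeo` with `hd`,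
`hinj` supplied by (a), (b). [folklore] -/
theorem eml_fibre_absolutelyContinuous_unitary (h : ι → Matrix.unitaryGroup (Fin N) ℂ) (c : ι → ℝ)
    (hc0 : ∀ i, 0 ≤ c i) (hc1 : ∑ i, c i < 1) {S : Set (Matrix.unitaryGroup (Fin N) ℂ)} (hS : IsOpen S)
    (hSg : ∀ W ∈ S, ∀ i, ‖((h i : Matrix (Fin N) (Fin N) ℂ)) * star (W : Matrix (Fin N) (Fin N) ℂ) - 1‖ < 1 / 2)
    {K : Matrix.unitaryGroup (Fin N) ℂ → Matrix.unitaryGroup (Fin N) ℂ} (hK : Measurable K)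
    (hKmat : ∀ W ∈ S, Kmat (fun i => (h i : Matrix (Fin N) (Fin N) ℂ)) c (W : Matrix (Fin N) (Fin N) ℂ)
      = ((K W : Matrix.unitaryGroup (Fin N) ℂ) : Matrix (Fin N) (Fin N) ℂ)) :
    ((haarProbability (Matrix.unitaryGroup (Fin N) ℂ)).restrict S).map K
      ≪ haarProbability (Matrix.unitaryGroup (Fin N) ℂ) :=
  haar_restrict_map_absolutelyContinuous_unitary hS hK
    (D := fun W => emlD (fun i => (h i : Matrix (Fin N) (Fin N) ℂ)) c (W : Matrix (Fin N) (Fin N) ℂ))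
    (fun W hW => hasStrictFDerivAt_Kmat _ c fun i => lt_trans (hSg W hW i) (by norm_num)) hKmat
    (fun W hW X hX hD => emlD_tangent_injective (fun i => (h i).2) W.2 (hSg W hW) hc0 hc1 X hX hD)

/-- **Fibre a.c. on `SU(N)`.**  The same with `hᵢ, W ∈ SU(N)` and `K : SU(N) → SU(N)`, through
`T4HaarSUNLocalDiffeo.haar_restrict_map_absolutelyContinuous_specialUnitary` (its tracelessness hypothesis is not even
needed by (b)). [folklore] -/
theorem eml_fibre_absolutelyContinuous_specialUnitary (h : ι → Matrix.specialUnitaryGroup (Fin N) ℂ) (c : ι → ℝ)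
    (hc0 : ∀ i, 0 ≤ c i) (hc1 : ∑ i, c i < 1) {S : Set (Matrix.specialUnitaryGroup (Fin N) ℂ)} (hS : IsOpen S)
    (hSg : ∀ W ∈ S, ∀ i, ‖((h i : Matrix (Fin N) (Fin N) ℂ)) * star (W : Matrix (Fin N) (Fin N) ℂ) - 1‖ < 1 / 2)
    {K : Matrix.specialUnitaryGroup (Fin N) ℂ → Matrix.specialUnitaryGroup (Fin N) ℂ} (hK : Measurable K)
    (hKmat : ∀ W ∈ S, Kmat (fun i => (h i : Matrix (Fin N) (Fin N) ℂ)) c (W : Matrix (Fin N) (Fin N) ℂ)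
      = ((K W : Matrix.specialUnitaryGroup (Fin N) ℂ) : Matrix (Fin N) (Fin N) ℂ)) :
    ((haarProbability (Matrix.specialUnitaryGroup (Fin N) ℂ)).restrict S).map K
      ≪ haarProbability (Matrix.specialUnitaryGroup (Fin N) ℂ) :=
  T4HaarSUNLocalDiffeo.haar_restrict_map_absolutelyContinuous_specialUnitary hS hK
    (D := fun W => emlD (fun i => (h i : Matrix (Fin N) (Fin N) ℂ)) c (W : Matrix (Fin N) (Fin N) ℂ))
    (fun W hW => hasStrictFDerivAt_Kmat _ c fun i => lt_trans (hSg W hW i) (by norm_num)) hKmat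
    (fun W hW X hX _ hD => emlD_tangent_injective (fun i => (Matrix.mem_specialUnitaryGroup_iff.mp (h i).2).1)
      (Matrix.mem_specialUnitaryGroup_iff.mp W.2).1 (hSg W hW) hc0 hc1 X hX hD)

/-- **The exp-mean-log tangent law on `SU(N)`, every `N ≥ 1`**, in the exact shape consumed by the general-`N` fibre-law
assembly (the contract «for all `h : ι → SU(N)`, `cᵢ ≥ 0`, `Σcᵢ < 1`, and guarded `W ∈ SU(N)` there is SOME strict real
derivative `D` of `M ↦ exp(Σᵢ cᵢ log(hᵢ M*)) · M` at `↑W` killing no non-zero traceless skew tangent vector `W X`»):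
`D := emlD`, by (a) and (b) (tracelessness unused). [folklore] -/
theorem emlTangentLaw_specialUnitary {ι : Type} [Fintype ι] (h : ι → Matrix.specialUnitaryGroup (Fin N) ℂ) (c : ι → ℝ)
    (hc0 : ∀ i, 0 ≤ c i) (hc1 : ∑ i, c i < 1) (W : Matrix.specialUnitaryGroup (Fin N) ℂ)
    (hg : ∀ i, ‖(h i : Matrix (Fin N) (Fin N) ℂ) * star (W : Matrix (Fin N) (Fin N) ℂ) - 1‖ < 1 / 2) :
    ∃ D : Matrix (Fin N) (Fin N) ℂ →L[ℝ] Matrix (Fin N) (Fin N) ℂ,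
      HasStrictFDerivAt
          (fun M : Matrix (Fin N) (Fin N) ℂ =>
            NormedSpace.exp (∑ i, (c i : ℂ) • MatrixLog.mlog ((h i : Matrix (Fin N) (Fin N) ℂ) * star M)) * M)
          D (W : Matrix (Fin N) (Fin N) ℂ) ∧
        ∀ X : Matrix (Fin N) (Fin N) ℂ, Xᴴ = -X → X.trace = 0 →
          D ((W : Matrix (Fin N) (Fin N) ℂ) * X) = 0 → X = 0 :=
  ⟨emlD (fun i => (h i : Matrix (Fin N) (Fin N) ℂ)) c (W : Matrix (Fin N) (Fin N) ℂ),
    hasStrictFDerivAt_Kmat (fun i => (h i : Matrix (Fin N) (Fin N) ℂ)) c fun i => lt_trans (hg i) (by norm_num),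
    fun X hX _ hD => emlD_tangent_injective (fun i => (Matrix.mem_specialUnitaryGroup_iff.mp (h i).2).1)
      (Matrix.mem_specialUnitaryGroup_iff.mp W.2).1 hg hc0 hc1 X hX hD⟩

/-- The same on `U(N)` (all skew tangent vectors). [folklore] -/
theorem emlTangentLaw_unitary {ι : Type} [Fintype ι] (h : ι → Matrix.unitaryGroup (Fin N) ℂ) (c : ι → ℝ)
    (hc0 : ∀ i, 0 ≤ c i) (hc1 : ∑ i, c i < 1) (W : Matrix.unitaryGroup (Fin N) ℂ)
    (hg : ∀ i, ‖(h i : Matrix (Fin N) (Fin N) ℂ) * star (W : Matrix (Fin N) (Fin N) ℂ) - 1‖ < 1 / 2) :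
    ∃ D : Matrix (Fin N) (Fin N) ℂ →L[ℝ] Matrix (Fin N) (Fin N) ℂ,
      HasStrictFDerivAt
          (fun M : Matrix (Fin N) (Fin N) ℂ =>
            NormedSpace.exp (∑ i, (c i : ℂ) • MatrixLog.mlog ((h i : Matrix (Fin N) (Fin N) ℂ) * star M)) * M)
          D (W : Matrix (Fin N) (Fin N) ℂ) ∧
        ∀ X : Matrix (Fin N) (Fin N) ℂ, Xᴴ = -X → D ((W : Matrix (Fin N) (Fin N) ℂ) * X) = 0 → X = 0 :=
  ⟨emlD (fun i => (h i : Matrix (Fin N) (Fin N) ℂ)) c (W : Matrix (Fin N) (Fin N) ℂ),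
    hasStrictFDerivAt_Kmat (fun i => (h i : Matrix (Fin N) (Fin N) ℂ)) c fun i => lt_trans (hg i) (by norm_num),
    fun X hX hD => emlD_tangent_injective (fun i => (h i).2) W.2 hg hc0 hc1 X hX hD⟩

end Unitary

end Literature.MathematicalPhysics.QuantumFieldTheory.Balaban1983to89.T4EMLTangentInjective

end
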